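import Literature.MathematicalPhysics.QuantumFieldTheory.Balaban1983to89.B8SectEStatements

/-!
# `Balaban1983to89.B8Eq1117Analytic` — B8 Sect. E p. 97: «This solution is an analytic function of λ»
# (analyticity of `D′(λ)`, the solution of (1.117), in `λ`) [Balaban1985RegularSpaces]

statement-level skeleton of published theorems with citation tags; proofs where landed; nothing here is a claim
about the Yang–Mills mass gap

CITATION HEADER (lean-in-tree rule 2026-08-18; mega-formalization `lit-balaban`, HOME
`run/shared/lean/pub/lit-balaban/`, reader/typer seat `lit-balaban-r05` gen 9 — SKELETON rows `B8.Eq1.113` ((1.113)–(1.118))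
and the p. 97 sentences next to `B8.Claim@97` of `HOME/lit-balaban-r05/ROWS-B8.md`; interface export E-B8-14 of
`HOME/lit-balaban-r05/INTERFACES-B8.md`; TAKING line `HOME/STATUS.md` 2026-08-21T09:08:30Z).  T. Bałaban, *Spaces of regular
gauge field configurations on a lattice and gauge fixing conditions*, Commun. Math. Phys. **99** (1985) 75–102
`[Balaban1985RegularSpaces]` ("B8"); [3] = T. Bałaban, *Averaging operations for lattice gauge theories*, Commun. Math.
Phys. **98** (1985) 17–51 `[Balaban1985Averaging]`.
PDF held: `paper:balaban1985-cmp99-regular-spaces-gauge-fixing` (journal page = PDF page + 74); pages read: pp. 96–97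
[PDF 22–23] (text layer `p0022.txt`, `p0023.txt`, this unit 2026-08-21).

THE PRINTED TEXT (p. 96 [PDF 22]) «We may admit configurations λ, X with values in the complexified algebra 𝔤ᶜ and all
the above equations and inequalities are valid also.»  (p. 97 [PDF 23]) «hence the mapping (1.118) is contractive if
e.g. α₃ + α₄ ≤ 1/(4C′₂B′₀). If the last condition is satisfied, then the mapping transforms the set {|X| < α₄/(2B′₀)}
into itself and is contractive on this set. Thus by the contraction mapping theorem there exists exactly one solution
of Eq. (1.117). This solution is an analytic function of λ defined on the set of λ satisfying (1.119). We take D′(λ)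
equal to this solution. From Eq. (1.116) we can get much better bounds on it: |D′(λ)| = |C′(λ − H′D′(λ))| <
C′₂(α₃ + α₄)α₄.»  The analyticity of `C′` in `λ` is [3] p. 50: «ũ′ʲ are analytic functions of λ, and Q′_j(u₁,λ) =
(1/i) log ũ′ʲ, j ≤ k, (208) are analytic functions of λ also» (`C′(λ) = Q′(u₁,λ) − Q′λ`, (213) of [3]).

WHAT IS REPRODUCED (abstraction level of `B8SectEStatements` = E-B8-14, now over `ℂ` as print's p. 96 sentence admits:
`Λ` = a complex Banach space of `𝔤ᶜ`-valued λ's normed so that the λ-clauses of (1.119)/(1.120) are norm balls, `F` = the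
complex Banach space of the `X : 𝔅_k → 𝔤ᶜ` with the sup norm, `C′ : Λ → F` with the printed inputs (1.121) [(214) of
[3]] and (1.125) and — the one new hypothesis — ANALYTIC on `‖μ‖ < α₄` [(208) of [3]], `H′ : F →L[ℂ] Λ` with
`‖H′‖ ≤ B′₀` [(1.92)], the printed smallness `α₃ + α₄ ≤ 1/(4B′₀C′₂)`; `D′` = `B8SectEStatements.Dprime C′ (H′|ℝ)
(α₄/(2B′₀))`, the solution of (1.117) in the ball `‖X‖ ≤ α₄/(2B′₀)` constructed in `B8SectEStatements`):
* `Dprime_contDiffAt` / **`Dprime_analyticAt`** / **`Dprime_analyticOnNhd`** — «This solution is an analytic function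
  of λ defined on the set of λ satisfying (1.119)»: `D′` is `ℂ`-analytic at every `λ₀` with `‖λ₀‖ < ½α₄` (the λ-part of
  (1.119)).  PROOF (print gives none; the standard one): at `(λ₀, X₀ = D′(λ₀))` the implicit equation
  `Φ(λ, X) = X − C′(λ − H′X) = 0` is analytic, and its partial derivative in `X`, `I + DC′(λ₀ − H′X₀)H′`, is
  invertible because `‖DC′‖ ≤ 2C′₂(α₃ + α₄)` (the Lipschitz bound (1.125), converse mean value inequality) and
  `‖H′‖ ≤ B′₀` give `‖DC′·H′‖ ≤ 2C′₂(α₃ + α₄)B′₀ ≤ ½ < 1` (Neumann series); Mathlib's analytic implicit function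
  theorem (`ContDiffAt.implicitFunction`, `n = ω`) yields an analytic `ψ` near `λ₀` with `ψ(λ₀) = X₀` and
  `Φ(λ, ψ(λ)) = 0`; since `‖X₀‖ < C′₂(α₃ + α₄)α₄ ≤ α₄/(4B′₀)` (`Dprime_bound`) lies strictly inside the ball, `ψ(λ)`
  stays in the ball near `λ₀`, so `ψ = D′` there by the uniqueness half of «exactly one solution» (`Dprime_unique`).
* `linMap_analyticAt` — hence the linearizing transformation (1.113) `λ ↦ λ − H′D′(λ)` is analytic on the same set.
* (v1.1, §4) `norm_sub_le_of_analytic_bound` — print's own route to (1.125): (1.122)–(1.125) in abstract norm form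
  (analytic + modulus bound `M` on the ball of radius `R` ⇒ Lipschitz `2M/R` on the half ball; Cauchy estimate + mean
  value inequality); `Dprime_analyticAt_of214` — `D′` analytic from the inputs of [3] alone ((214) on the balls of
  radii `α₄` and `2α₄`, (208) analyticity, `‖H′‖ ≤ B′₀`), constant `C′₂ ↦ 2C′₂` in the smallness (G-B8-17 reading).
HONEST SCOPE.  Abstract Banach level only (as E-B8-14); the concrete lattice remainder `C′ = C′_j(u₁,·)` of
`B8Eq1123Concrete`/`B8Eq1117Concrete` (unit p05) is NOT shown here to be analytic as a map of Banach spaces, so no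
concrete corollary is claimed.  The `|Dλ|`-clause of (1.119) is part of the norm of `Λ` (as in `B8SectEStatements`).
DECLARATIONS: theorems only (no `def`, no `… : Prop` fact).  REUSED BY NAME: `B8SectEStatements.Dprime`, `Dprime_spec`,
`Dprime_unique`, `Dprime_bound`, `norm_arg_lt`, `linMap`; Mathlib `ContDiffAt.implicitFunction`,
`ContDiffAt.contDiffAt_implicitFunction`, `ContDiffAt.eventually_apply_implicitFunction`,
`ContDiffAt.implicitFunction_apply_self`, `HasFDerivAt.le_of_lip'`, `Units.oneSub`, `ContDiffAt.analyticAt`.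
Unit `lit-balaban-r05` (gen 9), 2026-08-21.  Nothing here is new mathematics.
-/

noncomputable section

namespace Literature.MathematicalPhysics.QuantumFieldTheory.Balaban1983to89.B8Eq1117Analytic

open Metric Filter
open scoped Topology ContDiff
open B8SectEStatements (Eq1117 Dprime Dprime_spec Dprime_unique Dprime_bound norm_arg_lt linMap)

variable {Λ F : Type*} [NormedAddCommGroup Λ] [NormedSpace ℂ Λ] [CompleteSpace Λ]
  [NormedAddCommGroup F] [NormedSpace ℂ F] [CompleteSpace F]

/-! ## §1 A Neumann-series helper: `I + T` is invertible for `‖T‖ < 1` -/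

/-- `I + T` is an invertible bounded operator when `‖T‖ < 1` (Neumann series, `Units.oneSub`; private plumbing for the
implicit function theorem below). [folklore] -/
private theorem isInvertible_id_add {T : F →L[ℂ] F} (hT : ‖T‖ < 1) :
    (ContinuousLinearMap.id ℂ F + T).IsInvertible := by
  have hT' : ‖-T‖ < 1 := by rwa [norm_neg]
  have hval : ((Units.oneSub (-T) hT' : (F →L[ℂ] F)ˣ) : F →L[ℂ] F) = ContinuousLinearMap.id ℂ F + T := by
    rw [Units.val_oneSub, sub_neg_eq_add]; rfl
  refine ContinuousLinearMap.IsInvertible.of_inverse (g := ((Units.oneSub (-T) hT')⁻¹ : (F →L[ℂ] F)ˣ)) ?_ ?_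
  · have h := (Units.oneSub (-T) hT').mul_inv
    rwa [ContinuousLinearMap.mul_def, ContinuousLinearMap.one_def, hval] at h
  · have h := (Units.oneSub (-T) hT').inv_mul
    rwa [ContinuousLinearMap.mul_def, ContinuousLinearMap.one_def, hval] at h

/-! ## §2 «This solution is an analytic function of λ» (p. 97) -/

/-- **p. 97 [PDF 23], verbatim: *"Thus by the contraction mapping theorem there exists exactly one solution of
Eq. (1.117). This solution is an analytic function of λ defined on the set of λ satisfying (1.119)."*** — `C^ω` form at
the abstract Banach level of `B8SectEStatements` over `ℂ` (p. 96: «We may admit configurations λ, X with values in the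
complexified algebra 𝔤ᶜ …»): under the printed inputs (1.121), (1.125), `‖H′‖ ≤ B′₀`, `α₃ + α₄ ≤ 1/(4B′₀C′₂)` and the
analyticity of `C′` on `‖μ‖ < α₄` [(208) of [3]], the solution `D′ = Dprime C′ H′ (α₄/(2B′₀))` of (1.117) is `C^ω`
(over `ℂ`) at every `λ₀` with `‖λ₀‖ < ½α₄`.  Proof by the analytic implicit function theorem at `(λ₀, D′(λ₀))` plus
the uniqueness clause of «exactly one solution» (module docstring).
[cite: Balaban1985RegularSpaces, p.97 («This solution is an analytic function of λ», after (1.125)); Balaban1985Averaging, (208) p.50] -/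
theorem Dprime_contDiffAt (C' : Λ → F) (H' : F →L[ℂ] Λ) {B₀' C₂' α₃ α₄ : ℝ}
    (hB : 0 < B₀') (hC : 0 < C₂') (h3 : 0 ≤ α₃) (h4 : 0 < α₄) (hH : ‖H'‖ ≤ B₀')
    (h121 : ∀ μ : Λ, ‖μ‖ < α₄ → ‖C' μ‖ < C₂' * (α₃ + α₄) * α₄)
    (h125 : ∀ μ₁ μ₂ : Λ, ‖μ₁‖ < α₄ → ‖μ₂‖ < α₄ → ‖C' μ₁ - C' μ₂‖ ≤ 2 * C₂' * (α₃ + α₄) * ‖μ₁ - μ₂‖)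
    (hsm : α₃ + α₄ ≤ 1 / (4 * B₀' * C₂'))
    (hA : ∀ μ : Λ, ‖μ‖ < α₄ → AnalyticAt ℂ C' μ)
    {lam₀ : Λ} (hlam₀ : ‖lam₀‖ < α₄ / 2) :
    ContDiffAt ℂ ω (Dprime C' (H'.restrictScalars ℝ) (α₄ / (2 * B₀'))) lam₀ := by
  -- the real-linear reading of `H′` used by `B8SectEStatements`
  have hHr : ‖H'.restrictScalars ℝ‖ ≤ B₀' := by rw [ContinuousLinearMap.norm_restrictScalars]; exact hH
  have hHr_apply : ∀ X : F, (H'.restrictScalars ℝ) X = H' X := fun X => rfl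
  -- the printed smallness in product form: C′₂(α₃+α₄)·B′₀ ≤ 1/4
  have hprod : C₂' * (α₃ + α₄) * B₀' ≤ 1 / 4 := by
    have h1 : C₂' * (α₃ + α₄) * B₀' ≤ C₂' * (1 / (4 * B₀' * C₂')) * B₀' :=
      mul_le_mul_of_nonneg_right (mul_le_mul_of_nonneg_left hsm hC.le) hB.le
    have h2 : C₂' * (1 / (4 * B₀' * C₂')) * B₀' = 1 / 4 := by field_simp
    linarith
  -- the base point X₀ = D′(λ₀): in the ball, solves (1.117), and strictly inside the ball by `Dprime_bound`
  obtain ⟨hball₀, hsol₀⟩ := Dprime_spec C' (H'.restrictScalars ℝ) hB hC h3 h4 hHr h121 h125 hsm hlam₀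
  have hbd₀ := Dprime_bound C' (H'.restrictScalars ℝ) hB hC h3 h4 hHr h121 h125 hsm hlam₀
  set X₀ : F := Dprime C' (H'.restrictScalars ℝ) (α₄ / (2 * B₀')) lam₀ with hX₀
  have hX₀_lt : ‖X₀‖ < α₄ / (2 * B₀') := by
    have h1 : C₂' * (α₃ + α₄) * α₄ ≤ α₄ / (4 * B₀') := by
      rw [le_div_iff₀ (by positivity)]
      nlinarith
    have h2 : α₄ / (4 * B₀') < α₄ / (2 * B₀') := by
      apply div_lt_div_of_pos_left h4 (by positivity)
      nlinarith
    exact hbd₀.trans_le h1 |>.trans h2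
  have hμ₀ : ‖lam₀ - H' X₀‖ < α₄ := norm_arg_lt (H'.restrictScalars ℝ) hB hHr hlam₀ hball₀
  unfold Eq1117 at hsol₀
  -- the implicit equation Φ(λ, X) = X − C′(λ − H′X)
  set Lm : Λ × F →L[ℂ] Λ :=
    ContinuousLinearMap.fst ℂ Λ F - H'.comp (ContinuousLinearMap.snd ℂ Λ F) with hLm
  have hLm_apply : ∀ v : Λ × F, Lm v = v.1 - H' v.2 := fun v => rfl
  set Φ : Λ × F → F := fun v => v.2 - C' (Lm v) with hΦ
  have hLm₀ : Lm (lam₀, X₀) = lam₀ - H' X₀ := rfl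
  -- Φ is analytic, hence C^ω, at (λ₀, X₀)
  have hA₀ : AnalyticAt ℂ C' (Lm (lam₀, X₀)) := by rw [hLm₀]; exact hA _ hμ₀
  have hΦan : AnalyticAt ℂ Φ (lam₀, X₀) :=
    analyticAt_snd.sub (hA₀.comp (Lm.analyticAt _))
  have hΦcd : ContDiffAt ℂ ω Φ (lam₀, X₀) := hΦan.contDiffAt
  -- the derivative of Φ: Φ′ = snd − DC′(λ₀ − H′X₀) ∘ Lm
  set T₀ : Λ →L[ℂ] F := fderiv ℂ C' (Lm (lam₀, X₀)) with hT₀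
  have hC'd : HasFDerivAt C' T₀ (Lm (lam₀, X₀)) := hA₀.differentiableAt.hasFDerivAt
  -- ‖DC′‖ ≤ 2C′₂(α₃+α₄): converse mean value inequality from the Lipschitz bound (1.125)
  have hT₀_norm : ‖T₀‖ ≤ 2 * C₂' * (α₃ + α₄) := by
    refine hC'd.le_of_lip' (by positivity) ?_
    have hopen : IsOpen {μ : Λ | ‖μ‖ < α₄} := isOpen_lt continuous_norm continuous_const
    have hmem : {μ : Λ | ‖μ‖ < α₄} ∈ 𝓝 (Lm (lam₀, X₀)) := hopen.mem_nhds (by rw [hLm₀]; exact hμ₀)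
    filter_upwards [hmem] with μ hμ
    exact h125 μ _ hμ (by rw [hLm₀]; exact hμ₀)
  set Φ' : Λ × F →L[ℂ] F := ContinuousLinearMap.snd ℂ Λ F - T₀.comp Lm with hΦ'
  have hΦd : HasFDerivAt Φ Φ' (lam₀, X₀) :=
    hasFDerivAt_snd.sub (hC'd.comp (lam₀, X₀) Lm.hasFDerivAt)
  -- the partial derivative in X is I + DC′·H′, invertible by the Neumann series
  have hpartial : Φ'.comp (ContinuousLinearMap.inr ℂ Λ F) = ContinuousLinearMap.id ℂ F + T₀.comp H' := by
    ext X
    simp [hΦ', hLm]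
  have hTH : ‖T₀.comp H'‖ < 1 := by
    calc ‖T₀.comp H'‖ ≤ ‖T₀‖ * ‖H'‖ := ContinuousLinearMap.opNorm_comp_le _ _
      _ ≤ 2 * C₂' * (α₃ + α₄) * B₀' := mul_le_mul hT₀_norm hH (norm_nonneg _) (by positivity)
      _ ≤ 1 / 2 := by nlinarith [hprod]
      _ < 1 := by norm_num
  have hinv : (fderiv ℂ Φ (lam₀, X₀) ∘L ContinuousLinearMap.inr ℂ Λ F).IsInvertible := by
    rw [hΦd.fderiv, hpartial]; exact isInvertible_id_add hTH
  -- the analytic implicit function ψ near λ₀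
  have hω : (ω : ℕ∞ω) ≠ 0 := by simp
  have hψ₀ : hΦcd.implicitFunction hω hinv lam₀ = X₀ := hΦcd.implicitFunction_apply_self hω hinv
  have hψcd : ContDiffAt ℂ ω (hΦcd.implicitFunction hω hinv) lam₀ := hΦcd.contDiffAt_implicitFunction hω hinv
  have hψeq : ∀ᶠ x in 𝓝 lam₀, Φ (x, hΦcd.implicitFunction hω hinv x) = Φ (lam₀, X₀) :=
    hΦcd.eventually_apply_implicitFunction hω hinv
  have hΦ₀ : Φ (lam₀, X₀) = 0 := by
    show X₀ - C' (Lm (lam₀, X₀)) = 0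
    rw [hLm₀, ← hHr_apply, hsol₀, sub_self]
  -- ψ stays strictly inside the ball near λ₀ (continuity at λ₀ and ‖X₀‖ < α₄/(2B′₀)); λ stays in the λ-ball
  have hψball : ∀ᶠ x in 𝓝 lam₀, ‖hΦcd.implicitFunction hω hinv x‖ < α₄ / (2 * B₀') := by
    have hc : ContinuousAt (hΦcd.implicitFunction hω hinv) lam₀ := hψcd.continuousAt
    have hopen : IsOpen {Y : F | ‖Y‖ < α₄ / (2 * B₀')} := isOpen_lt continuous_norm continuous_const
    exact hc.preimage_mem_nhds (hopen.mem_nhds (by rw [Set.mem_setOf_eq, hψ₀]; exact hX₀_lt))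
  have hlamball : ∀ᶠ x in 𝓝 lam₀, ‖x‖ < α₄ / 2 :=
    (isOpen_lt continuous_norm continuous_const).mem_nhds hlam₀
  -- hence D′ = ψ near λ₀, by the uniqueness clause of «exactly one solution of Eq. (1.117)»
  have hEq : Dprime C' (H'.restrictScalars ℝ) (α₄ / (2 * B₀')) =ᶠ[𝓝 lam₀] hΦcd.implicitFunction hω hinv := by
    filter_upwards [hψeq, hψball, hlamball] with x hx hxb hxl
    have hsolx : Eq1117 C' (H'.restrictScalars ℝ) x (hΦcd.implicitFunction hω hinv x) := by
      rw [hΦ₀] at hx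
      have hx' : hΦcd.implicitFunction hω hinv x - C' (x - H' (hΦcd.implicitFunction hω hinv x)) = 0 := hx
      show C' (x - (H'.restrictScalars ℝ) (hΦcd.implicitFunction hω hinv x)) = hΦcd.implicitFunction hω hinv x
      rw [hHr_apply]
      exact (sub_eq_zero.mp hx').symm
    exact (Dprime_unique C' (H'.restrictScalars ℝ) hB hC h3 h4 hHr h121 h125 hsm hxl hxb.le hsolx).symm
  exact hψcd.congr_of_eventuallyEq hEq

/-- **«This solution is an analytic function of λ»** p. 97 [PDF 23] — analytic form: under the hypotheses of
`Dprime_contDiffAt`, `D′ = Dprime C′ H′ (α₄/(2B′₀))` is `ℂ`-analytic at every `λ₀` with `‖λ₀‖ < ½α₄`.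
[cite: Balaban1985RegularSpaces, p.97 («This solution is an analytic function of λ», after (1.125)); Balaban1985Averaging, (208) p.50] -/
theorem Dprime_analyticAt (C' : Λ → F) (H' : F →L[ℂ] Λ) {B₀' C₂' α₃ α₄ : ℝ}
    (hB : 0 < B₀') (hC : 0 < C₂') (h3 : 0 ≤ α₃) (h4 : 0 < α₄) (hH : ‖H'‖ ≤ B₀')
    (h121 : ∀ μ : Λ, ‖μ‖ < α₄ → ‖C' μ‖ < C₂' * (α₃ + α₄) * α₄)
    (h125 : ∀ μ₁ μ₂ : Λ, ‖μ₁‖ < α₄ → ‖μ₂‖ < α₄ → ‖C' μ₁ - C' μ₂‖ ≤ 2 * C₂' * (α₃ + α₄) * ‖μ₁ - μ₂‖)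
    (hsm : α₃ + α₄ ≤ 1 / (4 * B₀' * C₂'))
    (hA : ∀ μ : Λ, ‖μ‖ < α₄ → AnalyticAt ℂ C' μ)
    {lam₀ : Λ} (hlam₀ : ‖lam₀‖ < α₄ / 2) :
    AnalyticAt ℂ (Dprime C' (H'.restrictScalars ℝ) (α₄ / (2 * B₀'))) lam₀ :=
  (Dprime_contDiffAt C' H' hB hC h3 h4 hH h121 h125 hsm hA hlam₀).analyticAt

/-- **«… defined on the set of λ satisfying (1.119)»** p. 97 [PDF 23] — the set form: `D′` is analytic on (a
neighbourhood of every point of) the open ball `‖λ‖ < ½α₄`, the λ-clause of (1.119).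
[cite: Balaban1985RegularSpaces, p.97 («analytic function of λ defined on the set of λ satisfying (1.119)»); Balaban1985Averaging, (208) p.50] -/
theorem Dprime_analyticOnNhd (C' : Λ → F) (H' : F →L[ℂ] Λ) {B₀' C₂' α₃ α₄ : ℝ}
    (hB : 0 < B₀') (hC : 0 < C₂') (h3 : 0 ≤ α₃) (h4 : 0 < α₄) (hH : ‖H'‖ ≤ B₀')
    (h121 : ∀ μ : Λ, ‖μ‖ < α₄ → ‖C' μ‖ < C₂' * (α₃ + α₄) * α₄)
    (h125 : ∀ μ₁ μ₂ : Λ, ‖μ₁‖ < α₄ → ‖μ₂‖ < α₄ → ‖C' μ₁ - C' μ₂‖ ≤ 2 * C₂' * (α₃ + α₄) * ‖μ₁ - μ₂‖)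
    (hsm : α₃ + α₄ ≤ 1 / (4 * B₀' * C₂'))
    (hA : ∀ μ : Λ, ‖μ‖ < α₄ → AnalyticAt ℂ C' μ) :
    AnalyticOnNhd ℂ (Dprime C' (H'.restrictScalars ℝ) (α₄ / (2 * B₀'))) (ball (0 : Λ) (α₄ / 2)) :=
  fun _ hlam => Dprime_analyticAt C' H' hB hC h3 h4 hH h121 h125 hsm hA (mem_ball_zero_iff.mp hlam)

/-! ## §3 Corollary: the linearizing transformation (1.113) is analytic -/

/-- The linearizing transformation **(1.113)** p. 95 [PDF 21] `λ′ = λ − H′D′(λ)` (`B8SectEStatements.linMap`) is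
`ℂ`-analytic at every `λ₀` with `‖λ₀‖ < ½α₄` (from `Dprime_analyticAt`: identity minus a bounded linear map of an
analytic function). [cite: Balaban1985RegularSpaces, (1.113) p.95; p.97 («This solution is an analytic function of λ»)] -/
theorem linMap_analyticAt (C' : Λ → F) (H' : F →L[ℂ] Λ) {B₀' C₂' α₃ α₄ : ℝ}
    (hB : 0 < B₀') (hC : 0 < C₂') (h3 : 0 ≤ α₃) (h4 : 0 < α₄) (hH : ‖H'‖ ≤ B₀')
    (h121 : ∀ μ : Λ, ‖μ‖ < α₄ → ‖C' μ‖ < C₂' * (α₃ + α₄) * α₄)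
    (h125 : ∀ μ₁ μ₂ : Λ, ‖μ₁‖ < α₄ → ‖μ₂‖ < α₄ → ‖C' μ₁ - C' μ₂‖ ≤ 2 * C₂' * (α₃ + α₄) * ‖μ₁ - μ₂‖)
    (hsm : α₃ + α₄ ≤ 1 / (4 * B₀' * C₂'))
    (hA : ∀ μ : Λ, ‖μ‖ < α₄ → AnalyticAt ℂ C' μ)
    {lam₀ : Λ} (hlam₀ : ‖lam₀‖ < α₄ / 2) :
    AnalyticAt ℂ (linMap C' (H'.restrictScalars ℝ) (α₄ / (2 * B₀'))) lam₀ := by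
  have hD := Dprime_analyticAt C' H' hB hC h3 h4 hH h121 h125 hsm hA hlam₀
  have hHD : AnalyticAt ℂ (fun lam => H' (Dprime C' (H'.restrictScalars ℝ) (α₄ / (2 * B₀')) lam)) lam₀ :=
    (H'.analyticAt _).comp hD
  have h := analyticAt_id.sub hHD
  exact h

/-! ## §4 (v1.1) Print's own route to (1.125): the Lipschitz bound of `C′` from its analyticity and a modulus bound,
by the Cauchy formula (1.122)–(1.125) — and `D′` analytic from the inputs of [3] alone ((214) + (208))

v1.1 (unit `lit-balaban-r05` gen 9, append-only).  p. 96–97 derive the contraction property from the ANALYTICITY of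
`C′`: «We have C′(λ − H′X₁) − C′(λ − H′X₂) = ∫₀¹ dt (∂/∂t)C′(…) = −∫₀¹ dt ⟨(δ/δλ)C′(λ − H′(tX₁ + (1−t)X₂)), H′(X₁ −
X₂)⟩ (1.122) … Using the analyticity properties of C′(λ), the derivative above can be written as ⟨(δ/δλ)C′(λ), λ₀⟩ =
(1/2πi)∮_{|τ|=r} dτ τ⁻² C′(λ + τλ₀). (1.124)  Taking r = (2max{|λ₀|, |Dλ₀|})⁻¹α₄, we get the estimate
|⟨(δ/δλ)C′(λ), λ₀⟩| ≤ C′₂ 2max{|λ₀|, |Dλ₀|}(α₃ + α₄) (1.125)».  At the abstraction level of this file (the norm of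
`Λ` is the max of the two printed seminorms, so `max{|λ₀|, |Dλ₀|} = ‖λ₀‖` and the sets (1.119)/(1.120) are the balls
of radii `½α₄`/`α₄`) this is the general statement `norm_sub_le_of_analytic_bound` below (radius `R`, modulus bound
`M`, Lipschitz constant `2M/R` on the half ball), proved exactly along the printed lines: Cauchy's estimate for the
derivative on the circle `|τ − t| = R/(2‖μ₁ − μ₂‖)` around each point of the segment (Mathlib
`Complex.norm_deriv_le_of_forall_mem_sphere_norm_le`), then the mean value inequality along the segment (1.122)
(`Convex.norm_image_sub_le_of_norm_deriv_le`).  As HOME/GAPS.md G-B8-17 records (p05 g5), the printed (1.125) is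
obtained for centres in the HALF-size set while the contraction argument uses it on the full-size set (1.120); the
honest knitting therefore takes (214) of [3] on the ball of radius `2α₄` as well and pays a factor 2 in the
constant: `Dprime_analyticAt_of214` feeds `Dprime_analyticAt` with `C′₂ ↦ 2C′₂` (smallness `α₃ + α₄ ≤
1/(8B′₀C′₂)` instead of print's `1/(4B′₀C′₂)`), its hypotheses being ONLY the printed inputs of [3] — (214) on the
balls `‖μ‖ < α₄` and `‖μ‖ < 2α₄` and the analyticity (208) on `‖μ‖ < 2α₄` — plus `‖H′‖ ≤ B′₀`. -/

omit [CompleteSpace Λ] [CompleteSpace F] in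
/-- **(1.122)–(1.125) pp. 96–97, abstract norm form** (verbatim above): if `C′` is `ℂ`-analytic on the ball
`‖μ‖ < R` with the modulus bound `‖C′(μ)‖ ≤ M` there, then on the half ball `‖μ‖ < R/2` it is Lipschitz with
constant `2M/R`: `‖C′(μ₁) − C′(μ₂)‖ ≤ (2M/R)‖μ₁ − μ₂‖` — Cauchy's estimate (1.124)–(1.125) on the circles of radius
`r = R/(2‖μ₁ − μ₂‖)` (print's `r = (2max{|λ₀|, |Dλ₀|})⁻¹α₄` with `R = α₄`, `λ₀ = μ₁ − μ₂`) around the points of the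
segment, then the mean value inequality (1.122) along the segment.
[cite: Balaban1985RegularSpaces, (1.122)–(1.125) pp.96–97] -/
theorem norm_sub_le_of_analytic_bound (C' : Λ → F) {R M : ℝ} (hR : 0 < R)
    (hA : ∀ μ : Λ, ‖μ‖ < R → AnalyticAt ℂ C' μ) (hB : ∀ μ : Λ, ‖μ‖ < R → ‖C' μ‖ ≤ M)
    {μ₁ μ₂ : Λ} (h₁ : ‖μ₁‖ < R / 2) (h₂ : ‖μ₂‖ < R / 2) :
    ‖C' μ₁ - C' μ₂‖ ≤ 2 * M / R * ‖μ₁ - μ₂‖ := by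
  by_cases hne : μ₁ = μ₂
  · subst hne; simp
  have hv : 0 < ‖μ₁ - μ₂‖ := norm_pos_iff.mpr (sub_ne_zero.mpr hne)
  -- the complex line through μ₂ in the direction v = μ₁ − μ₂, and print's radius r
  set v : Λ := μ₁ - μ₂ with hv_def
  set g : ℂ → F := fun τ => C' (μ₂ + τ • v) with hg
  set r : ℝ := R / (2 * ‖v‖) with hr
  have hr_pos : 0 < r := by positivity
  have hrv : r * ‖v‖ = R / 2 := by rw [hr]; field_simp
  -- the points of the real segment [0,1] ⊂ ℂ parametrise the segment from μ₂ to μ₁, inside the half ball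
  have hseg : ∀ x ∈ segment ℝ (0:ℂ) 1, ‖μ₂ + x • v‖ < R / 2 := by
    intro x hx
    rw [segment_eq_image'] at hx
    obtain ⟨θ, hθ, rfl⟩ := hx
    have hθc : (fun θ : ℝ => (0:ℂ) + θ • ((1:ℂ) - 0)) θ • v = (θ : ℝ) • v := by
      simp only [sub_zero, zero_add, Complex.real_smul, mul_one, Complex.coe_smul]
    rw [hθc]
    have hmem : (1 - θ) • μ₂ + θ • μ₁ ∈ ball (0:Λ) (R / 2) :=
      (convex_ball (0:Λ) (R / 2)) (mem_ball_zero_iff.mpr h₂) (mem_ball_zero_iff.mpr h₁)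
        (by linarith [hθ.2]) hθ.1 (by ring)
    have heq : μ₂ + θ • (μ₁ - μ₂) = (1 - θ) • μ₂ + θ • μ₁ := by
      rw [smul_sub, sub_smul, one_smul]; abel
    rw [hv_def, heq]
    exact mem_ball_zero_iff.mp hmem
  -- points of ℂ within distance r of the segment are mapped into the ball of radius R ((1.120)-type bound)
  have hnear : ∀ x ∈ segment ℝ (0:ℂ) 1, ∀ τ : ℂ, ‖τ - x‖ ≤ r → ‖μ₂ + τ • v‖ < R := by
    intro x hx τ hτ
    have h1 := hseg x hx
    have hsplit : μ₂ + τ • v = (μ₂ + x • v) + (τ - x) • v := by rw [sub_smul]; abel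
    rw [hsplit]
    calc ‖(μ₂ + x • v) + (τ - x) • v‖ ≤ ‖μ₂ + x • v‖ + ‖(τ - x) • v‖ := norm_add_le _ _
      _ = ‖μ₂ + x • v‖ + ‖τ - x‖ * ‖v‖ := by rw [norm_smul]
      _ ≤ ‖μ₂ + x • v‖ + r * ‖v‖ := by gcongr
      _ < R / 2 + R / 2 := by rw [hrv]; linarith
      _ = R := by ring
  -- hence g is ℂ-differentiable there
  have hgdiff : ∀ x ∈ segment ℝ (0:ℂ) 1, ∀ τ : ℂ, ‖τ - x‖ ≤ r → DifferentiableAt ℂ g τ := by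
    intro x hx τ hτ
    have hAτ : AnalyticAt ℂ C' (μ₂ + τ • v) := hA _ (hnear x hx τ hτ)
    have haff : DifferentiableAt ℂ (fun σ : ℂ => μ₂ + σ • v) τ := by fun_prop
    exact hAτ.differentiableAt.comp τ haff
  -- (1.124)–(1.125): Cauchy's estimate ‖g′(x)‖ ≤ M/r = (2M/R)‖v‖ at every point of the segment
  have hderiv : ∀ x ∈ segment ℝ (0:ℂ) 1, ‖deriv g x‖ ≤ 2 * M / R * ‖v‖ := by
    intro x hx
    have hd : DiffContOnCl ℂ g (ball x r) := by
      refine DifferentiableOn.diffContOnCl ?_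
      intro τ hτ
      rw [closure_ball x hr_pos.ne'] at hτ
      exact (hgdiff x hx τ (mem_closedBall_iff_norm.mp hτ)).differentiableWithinAt
    have hMs : ∀ z ∈ sphere x r, ‖g z‖ ≤ M := fun z hz =>
      hB _ (hnear x hx z (mem_sphere_iff_norm.mp hz).le)
    calc ‖deriv g x‖ ≤ M / r := Complex.norm_deriv_le_of_forall_mem_sphere_norm_le hr_pos hd hMs
      _ = 2 * M / R * ‖v‖ := by rw [hr]; field_simp
  -- (1.122): the mean value inequality along the segment
  have hmv := Convex.norm_image_sub_le_of_norm_deriv_le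
    (fun x hx => hgdiff x hx x (by simp [hr_pos.le])) hderiv (convex_segment (0:ℂ) 1)
    (left_mem_segment ℝ (0:ℂ) 1) (right_mem_segment ℝ (0:ℂ) 1)
  have hg1 : g 1 = C' μ₁ := by simp [hg, hv_def]
  have hg0 : g 0 = C' μ₂ := by simp [hg]
  rw [hg1, hg0] at hmv
  simpa using hmv

/-- **«This solution is an analytic function of λ» from the inputs of [3] alone.**  Hypotheses: (214) of [3] on the
ball `‖μ‖ < α₄` [(1.121): `‖C′(μ)‖ < C′₂(α₃ + α₄)α₄`] and on the ball `‖μ‖ < 2α₄` [`‖C′(μ)‖ < C′₂(α₃ + 2α₄)·2α₄`],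
the analyticity (208) of `C′` on `‖μ‖ < 2α₄`, `‖H′‖ ≤ B′₀` [(1.92)], and the smallness `α₃ + α₄ ≤ 1/(8B′₀C′₂)` (print:
`1/(4C′₂B′₀)`; the factor 2 is the price of using (1.125) on the full-size set (1.120), HOME/GAPS.md G-B8-17).
Conclusion: `D′ = Dprime C′ H′ (α₄/(2B′₀))` is `ℂ`-analytic at every `‖λ₀‖ < ½α₄`.  Proof: (1.125) on `‖μ‖ < α₄`
with constant `2C′₂(α₃ + 2α₄) ≤ 2·(2C′₂)(α₃ + α₄)` by `norm_sub_le_of_analytic_bound` (R = 2α₄), then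
`Dprime_analyticAt` with `C′₂ ↦ 2C′₂`.
[cite: Balaban1985RegularSpaces, p.97 («This solution is an analytic function of λ»), (1.121) p.96, (1.122)–(1.125) pp.96–97; Balaban1985Averaging, (208), (214) p.50] -/
theorem Dprime_analyticAt_of214 (C' : Λ → F) (H' : F →L[ℂ] Λ) {B₀' C₂' α₃ α₄ : ℝ}
    (hB : 0 < B₀') (hC : 0 < C₂') (h3 : 0 ≤ α₃) (h4 : 0 < α₄) (hH : ‖H'‖ ≤ B₀')
    (h121 : ∀ μ : Λ, ‖μ‖ < α₄ → ‖C' μ‖ < C₂' * (α₃ + α₄) * α₄)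
    (h214 : ∀ μ : Λ, ‖μ‖ < 2 * α₄ → ‖C' μ‖ < C₂' * (α₃ + 2 * α₄) * (2 * α₄))
    (hA : ∀ μ : Λ, ‖μ‖ < 2 * α₄ → AnalyticAt ℂ C' μ)
    (hsm : α₃ + α₄ ≤ 1 / (8 * B₀' * C₂')) {lam₀ : Λ} (hlam₀ : ‖lam₀‖ < α₄ / 2) :
    AnalyticAt ℂ (Dprime C' (H'.restrictScalars ℝ) (α₄ / (2 * B₀'))) lam₀ := by
  -- (1.125) on the ball ‖μ‖ < α₄, from analyticity + (214) on the doubled ball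
  have h125 : ∀ μ₁ μ₂ : Λ, ‖μ₁‖ < α₄ → ‖μ₂‖ < α₄ →
      ‖C' μ₁ - C' μ₂‖ ≤ 2 * (2 * C₂') * (α₃ + α₄) * ‖μ₁ - μ₂‖ := by
    intro μ₁ μ₂ hμ₁ hμ₂
    have hR : (0:ℝ) < 2 * α₄ := by positivity
    have h := norm_sub_le_of_analytic_bound C' hR hA (fun μ hμ => (h214 μ hμ).le)
      (show ‖μ₁‖ < 2 * α₄ / 2 by linarith) (show ‖μ₂‖ < 2 * α₄ / 2 by linarith)
    have hc : 2 * (C₂' * (α₃ + 2 * α₄) * (2 * α₄)) / (2 * α₄) = 2 * C₂' * (α₃ + 2 * α₄) := by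
      field_simp
    rw [hc] at h
    have hle : 2 * C₂' * (α₃ + 2 * α₄) ≤ 2 * (2 * C₂') * (α₃ + α₄) := by nlinarith
    exact h.trans (mul_le_mul_of_nonneg_right hle (norm_nonneg _))
  -- (1.121) with the doubled constant
  have h121' : ∀ μ : Λ, ‖μ‖ < α₄ → ‖C' μ‖ < (2 * C₂') * (α₃ + α₄) * α₄ := by
    intro μ hμ
    have h := h121 μ hμ
    have hnn : 0 ≤ C₂' * (α₃ + α₄) * α₄ := by positivity
    linarith
  have hsm' : α₃ + α₄ ≤ 1 / (4 * B₀' * (2 * C₂')) := by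
    rw [show 4 * B₀' * (2 * C₂') = 8 * B₀' * C₂' by ring]; exact hsm
  exact Dprime_analyticAt C' H' hB (by positivity) h3 h4 hH h121' h125 hsm'
    (fun μ hμ => hA μ (by linarith)) hlam₀

end Literature.MathematicalPhysics.QuantumFieldTheory.Balaban1983to89.B8Eq1117Analytic
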